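import Summits.QuantumFields.YangMills.Theorems.BalabanUVNodesN15TwoSpacingGluingCurvedKnitCovariantLandauFlatRowsAtIndex
import HarnessLib

/-!
# Route «BalabanUVNodes», node N15 = NE2, road (c) — THE η-RATE OF KING's PAIRED COUPLINGS: `0 ≤ a_K − a_{n+K} ≤ (4∕3)·a·L^{−2K} ≤ (4∕3)·a·(L^K)^{−γ}` (`γ ≤ 2`) —
# the mass-window letter `|a_w′ − a_w| ≤ C_a·S` of dag-n15-c g25's 256 ∕ 234′ for the King masses of (Ξ-6) `flatRowsAll_sfIdx` (dag-n15-a g34, (Ξ-7))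

Cell `pub-ymgap`, seat `pub-ymgap-dag-n15-a` (generation g34; KNIT-BY-NAME lane; HUMAN RULING D-0062; chair R424 venue).  `bears_on: R4∕N15 · K3⁸ SpineGivenEndpointR13SepCoPHV
(stmt-QuantumFields-27366)`; filed `--supports stmt-QuantumFields-27366 --as helper` — COUNT-NEUTRAL.  Theorems only; 0 `sorry`; elementary real algebra on King's printed couplings
`a_k = a(1 − L⁻²)(1 − L^{−2k})⁻¹` ([King1986] (2.13)) through the tree's `King1986.inv_aK_add` (`a_{k+n}⁻¹ = a_k⁻¹ + L^{−2k}a_n⁻¹`), `aK_le`, `aK_ge`, `aK_pos`.  Imports (Ξ-6) (for the namespace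
and `aK`); nothing in the tree is modified.

WHY.  (Ξ-6) feeds the (G3) road's flat rows at King's PAIRED couplings `a_w := aK 1 L kk` (coarse) and `a_w′ := aK 1 L (r + kk)` (fine).  dag-n15-c g25's exp-level defect row (256
`hasMaj_idef_landauCov_sub_landauRe_exp`, then 234′) displays, besides the flat rows, the letter `|a_w′ − a_w| ≤ C_a·S` — the two mass windows must agree to the η-scale `S`.  For King's
couplings this is EXACT algebra: `a_K − a_{n+K} = a_K·a_{n+K}·L^{−2K}∕a_n ∈ [0, a·L^{−2K}∕(1 − L⁻²)]`, and `L^{−2K} ≤ (L^K)^{−γ}` for `γ ≤ 2`.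
* `aK_sub_aK_add_eq` (the identity), `aK_add_le_aK` (monotone: `a_{n+K} ≤ a_K`), ★ `aK_sub_aK_add_le` (`a_K − a_{n+K} ≤ (4∕3)·a·(L^{2K})⁻¹`, `L ≥ 2`),
  ★★ `abs_aK_add_sub_aK_le_rpow` (`|a_{n+K} − a_K| ≤ (4∕3)·a·(L^K)^{−γ}`, `γ ≤ 2`) — the letter for (Ξ-6)'s masses (`a := 1`).

HONEST FRAMING ∕ LIMITS.  Elementary; about King's MODEL couplings only; NOT an estimate of [Balaban1985BackgroundPropagators]; NE2⁺ NOT PRINTED; N15 of record untouched (DISCHARGED AS CONSUMED,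
p687738); counts UNMOVED (typed 28∕28 · discharged 8∕27); nothing continuum ∕ OS ∕ mass gap ∕ Clay.  Restate-immune (no Theses import).  No `sorry`, `instance`, `notation`; standard axioms.
-/

noncomputable section

namespace Summit.QuantumFields.YangMills.BalabanUVNodes.N15.CovLandau

open Literature.MathematicalPhysics.QuantumFieldTheory.King1986 (aK aK_pos aK_le aK_ge inv_aK_add one_sub_inv_pow_pos)

/-- THE IDENTITY behind the rate: `a_K − a_{K+n} = a_K·a_{K+n}·(L^{2K})⁻¹·a_n⁻¹` (from `a_{K+n}⁻¹ = a_K⁻¹ + L^{−2K}a_n⁻¹`). [cite: King1986, (2.13) p.653, (4.12) p.671] -/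
theorem aK_sub_aK_add_eq {a L : ℝ} (ha : 0 < a) (hL : 1 < L) {K : ℕ} (n : ℕ) (hK : 1 ≤ K) :
    aK a L K - aK a L (K + n) = aK a L K * aK a L (K + n) * ((L ^ (2 * K))⁻¹ * (aK a L n)⁻¹) := by
  have hK' : 0 < aK a L K := aK_pos ha hL hK
  have hKn : 0 < aK a L (K + n) := aK_pos ha hL (le_add_right hK)
  have h := inv_aK_add ha hL K n
  -- multiply the identity `a_{K+n}⁻¹ − a_K⁻¹ = L^{−2K}a_n⁻¹` by `a_K·a_{K+n}`
  have h2 : (aK a L (K + n))⁻¹ - (aK a L K)⁻¹ = (L ^ (2 * K))⁻¹ * (aK a L n)⁻¹ := by rw [h]; ring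
  calc aK a L K - aK a L (K + n) = aK a L K * aK a L (K + n) * ((aK a L (K + n))⁻¹ - (aK a L K)⁻¹) := by
        field_simp
    _ = aK a L K * aK a L (K + n) * ((L ^ (2 * K))⁻¹ * (aK a L n)⁻¹) := by rw [h2]

/-- King's couplings DECREASE along the flow: `a_{K+n} ≤ a_K`. [cite: King1986, (2.13) p.653] -/
theorem aK_add_le_aK {a L : ℝ} (ha : 0 < a) (hL : 1 < L) {K n : ℕ} (hK : 1 ≤ K) (hn : 1 ≤ n) : aK a L (K + n) ≤ aK a L K := by
  have hL0 : 0 < L := by linarith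
  have hsub := aK_sub_aK_add_eq ha hL n hK
  have hnonneg : 0 ≤ aK a L K * aK a L (K + n) * ((L ^ (2 * K))⁻¹ * (aK a L n)⁻¹) :=
    mul_nonneg (mul_nonneg (aK_pos ha hL hK).le (aK_pos ha hL (le_add_right hK)).le)
      (mul_nonneg (inv_nonneg.mpr (pow_nonneg hL0.le _)) (inv_nonneg.mpr (aK_pos ha hL hn).le))
  linarith

/-- ★ **THE η-RATE OF THE PAIRED COUPLINGS**: for `L ≥ 2`, `a > 0`, `K, n ≥ 1`: `0 ≤ a_K − a_{K+n} ≤ (4∕3)·a·(L^{2K})⁻¹` (`a_K, a_{K+n} ≤ a`, `a_n ≥ a(1 − L⁻²) ≥ (3∕4)a`).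
[cite: King1986, (2.13) p.653] -/
theorem aK_sub_aK_add_le {a L : ℝ} (ha : 0 < a) (hL : 2 ≤ L) {K n : ℕ} (hK : 1 ≤ K) (hn : 1 ≤ n) :
    aK a L K - aK a L (K + n) ≤ 4 / 3 * a * (L ^ (2 * K))⁻¹ := by
  have hL1 : 1 < L := by linarith
  have hL0 : 0 < L := by linarith
  have hpow : 0 < (L ^ (2 * K))⁻¹ := inv_pos.mpr (pow_pos hL0 _)
  have hK' := aK_le ha hL1 hK
  have hKn := aK_le ha hL1 (le_add_right hK : 1 ≤ K + n)
  have hKpos := (aK_pos ha hL1 hK).le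
  have hKnpos := (aK_pos ha hL1 (le_add_right hK : 1 ≤ K + n)).le
  -- `a_n ≥ a(1 − L⁻²) ≥ (3/4)a`
  have hn' : 3 / 4 * a ≤ aK a L n := by
    have h1 := aK_ge ha hL1 hn
    have hL4 : (4 : ℝ) ≤ L ^ 2 := by nlinarith
    have hinv : (L ^ 2)⁻¹ ≤ 1 / 4 := by rw [one_div]; exact inv_anti₀ (by norm_num) hL4
    nlinarith
  have hn0 : 0 < aK a L n := aK_pos ha hL1 hn
  have hinvn : (aK a L n)⁻¹ ≤ (3 / 4 * a)⁻¹ := inv_anti₀ (by positivity) hn'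
  rw [aK_sub_aK_add_eq ha hL1 n hK]
  calc aK a L K * aK a L (K + n) * ((L ^ (2 * K))⁻¹ * (aK a L n)⁻¹)
      ≤ a * a * ((L ^ (2 * K))⁻¹ * (3 / 4 * a)⁻¹) :=
        mul_le_mul (mul_le_mul hK' hKn hKnpos ha.le) (mul_le_mul_of_nonneg_left hinvn hpow.le) (mul_nonneg hpow.le (inv_nonneg.mpr hn0.le)) (mul_nonneg ha.le ha.le)
    _ = 4 / 3 * a * (L ^ (2 * K))⁻¹ := by field_simp

/-- ★★ **THE MASS-WINDOW LETTER FOR (Ξ-6)'s KING MASSES**: for `L ≥ 2`, `a > 0`, `K ≥ 1`, every `n` and `γ ≤ 2`: `|a_{n+K} − a_K| ≤ (4∕3)·a·(L^K)^{−γ}` (the fine and coarse mass windows of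
the (G3) road agree to the η-scale; `n = 0`: the difference is `0`). [cite: King1986, (2.13) p.653] -/
theorem abs_aK_add_sub_aK_le_rpow {a L : ℝ} (ha : 0 < a) (hL : 2 ≤ L) {K : ℕ} (hK : 1 ≤ K) (n : ℕ) {γ : ℝ} (hγ2 : γ ≤ 2) :
    |aK a L (n + K) - aK a L K| ≤ 4 / 3 * a * (L ^ K) ^ (-γ) := by
  have hL1 : (1 : ℝ) ≤ L := by linarith
  have hL0 : 0 < L := by linarith
  have hLK1 : (1 : ℝ) ≤ L ^ K := one_le_pow₀ hL1
  have hLK0 : (0 : ℝ) < L ^ K := by positivity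
  -- `L^{−2K} ≤ (L^K)^{−γ}` for `γ ≤ 2`
  have hrate : (L ^ (2 * K))⁻¹ ≤ (L ^ K) ^ (-γ) := by
    rw [show (L ^ (2 * K))⁻¹ = (L ^ K) ^ (-(2 : ℝ)) by rw [Real.rpow_neg hLK0.le, Real.rpow_two, pow_mul']]
    exact Real.rpow_le_rpow_of_exponent_le hLK1 (by linarith)
  rcases Nat.eq_zero_or_pos n with hn0 | hn
  · subst hn0
    rw [Nat.zero_add, sub_self, abs_zero]
    positivity
  · rw [Nat.add_comm n K, abs_sub_comm, abs_of_nonneg (sub_nonneg.mpr (aK_add_le_aK ha (by linarith) hK hn))]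
    exact (aK_sub_aK_add_le ha hL hK hn).trans (mul_le_mul_of_nonneg_left hrate (by positivity))

end Summit.QuantumFields.YangMills.BalabanUVNodes.N15.CovLandau

end
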